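import Summits.Ventures.HSemireg.WedgeHankelPairMixingProjection

/-!
# Venture HSemireg — THE IMAGE OF A KERNEL UNDER AN ARBITRARY (SINGULAR) PAIR MIXING: for EVERY matrix `M`, `Pm(M)(Kr(univ, w_N q, k)) = Pm(Q)(Kr ⊓ Sp(pairs ⊆ T))` for an
# INVERTIBLE `Q` and a set of pairs `T` with `|T| = rank M` — after a change of frame in the factors, the image of the kernel is the part of the kernel supported on `rank M`
# pairs (and the same for the images `V`); hence `dim Pm(M)(Kr) = dim (Kr ⊓ Sp(pairs ⊆ T))`

HONEST FRAMING. Part of the Lean index of the computation cell `pub-hsemireg` (seat p10 gen 20, Sunday typer «UNIFORM-IN-n»).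
Finite-dimensional EXTERIOR ALGEBRA over a field ONLY: no variety, no cohomology theory, no sheaf, no Ext group, no semiregularity map;
nothing here says that HC / HC_CM / HC_AV holds; no Literature fact is declared or used (the factorisation `M = L·diagonal(D)·L′` into transvections is Mathlib's
`Matrix.Pivot.exists_list_transvec_mul_diagonal_mul_list_transvec`).  Custodian versions as in `WedgeHankelSiegelIdeal` (1/3).

WHAT IS IN THE TREE.  J6 (`WedgeHankelPairMixingProjection`): `map_Pm_indicator_Kr_w` / `_V_w` (the coordinate projections); H9b (`WedgeHankelPairMixingDet`): `map_PmE_Kr_w` / `map_PmE_V_w`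
(invertible mixings fix `Kr` and `V`), `PmE_apply`; H9 `Pm_mul`.  I5's «NOT typed: the image `Pm M (Kr)` for singular `M` as a named subspace … only after a change of frame» is
THIS FILE (namespace `Summit.Ventures.HSemireg.Wedge.HankelPairMixing` continued; imports J6):
* §255 `map_Pm_mul` (images under a product), `map_Pm_Kr_w_of_det_ne_zero` / `map_Pm_V_w_of_det_ne_zero` (H9b restated for `Pm`), `finrank_map_Pm_of_det_ne_zero`;
  `diagonal_eq_support_mul_indicator` (`diagonal d = diagonal d′ · diagonal 1_T`, `T = supp d`, `d′` invertible), `det_diagonal_support_ne_zero`, `card_support_eq_rank_diagonal`.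
* §256 **`exists_map_Pm_Kr_w_eq`: for EVERY `M` there are `Q` with `det Q ≠ 0` and `T` with `T.card = M.rank` such that `Pm(M)(Kr(univ, w_N q, k)) = Pm(Q)(Kr(univ, w_N q, k) ⊓
  Sp(pairs ⊆ T))`**, **`exists_map_Pm_V_w_eq`** (the same for `V`), and **`exists_finrank_map_Pm_Kr_w_eq`** (`dim Pm(M)(Kr) = dim (Kr ⊓ Sp(pairs ⊆ T))` for some `T` of size `rank M`).
NOT typed here: that `dim (Kr ⊓ Sp(pairs ⊆ T))` depends only on `T.card` (pair permutations), and its value (I10's fibre sums); anything Ext-side.  Class side only; new names only.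
-/

open Module

namespace Summit.Ventures.HSemireg.Wedge.HankelPairMixing

open Summit.Ventures.HSemireg.Wedge Summit.Ventures.HSemireg.Wedge.Kunneth Summit.Ventures.HSemireg.Wedge.Hankel
  Summit.Ventures.HSemireg.Wedge.KunnethKernel Summit.Ventures.HSemireg.Wedge.Weil Summit.Ventures.HSemireg.Wedge.HankelPairGrading

variable (K : Type*) [Field K] {N : ℕ}

/-! ## §255. Products, invertible factors, and the splitting of a diagonal mixing -/

/-- images under a product of mixings: `Pm(M·M′)(W) = Pm(M)(Pm(M′)(W))`. -/
theorem map_Pm_mul (M M' : Matrix (Fin N) (Fin N) K) (W : Submodule K (HT K (In N))) :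
    W.map (Pm K (M * M')).toLinearMap = (W.map (Pm K M').toLinearMap).map (Pm K M).toLinearMap := by
  rw [Pm_mul, AlgHom.comp_toLinearMap, Submodule.map_comp]

/-- an invertible mixing fixes every kernel of th-7's class (H9b `map_PmE_Kr_w`, for `Pm`). -/
theorem map_Pm_Kr_w_of_det_ne_zero {M : Matrix (Fin N) (Fin N) K} (hM : M.det ≠ 0) (q : ℕ → K) (k : ℕ) :
    (Kr K Finset.univ (w K N N q) k).map (Pm K M).toLinearMap = Kr K Finset.univ (w K N N q) k := by
  have e : (Pm K M).toLinearMap = (PmE K (n := N) hM).toLinearMap := LinearMap.ext fun _ => rfl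
  rw [e]; exact map_PmE_Kr_w K hM q k

/-- an invertible mixing fixes every image of th-7's class (H9b `map_PmE_V_w`, for `Pm`). -/
theorem map_Pm_V_w_of_det_ne_zero {M : Matrix (Fin N) (Fin N) K} (hM : M.det ≠ 0) (q : ℕ → K) (k : ℕ) :
    (V K (In N) Finset.univ (w K N N q) k).map (Pm K M).toLinearMap = V K (In N) Finset.univ (w K N N q) k := by
  have e : (Pm K M).toLinearMap = (PmE K (n := N) hM).toLinearMap := LinearMap.ext fun _ => rfl
  rw [e]; exact map_PmE_V_w K hM q k

/-- an invertible mixing preserves dimensions of subspaces. -/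
theorem finrank_map_Pm_of_det_ne_zero {M : Matrix (Fin N) (Fin N) K} (hM : M.det ≠ 0) (W : Submodule K (HT K (In N))) :
    finrank K ↥(W.map (Pm K M).toLinearMap) = finrank K W := by
  have e : (Pm K M).toLinearMap = ((PmE K (n := N) hM).toLinearEquiv : HT K (In N) →ₗ[K] HT K (In N)) := LinearMap.ext fun _ => rfl
  rw [e]; exact LinearEquiv.finrank_map_eq _ W

/-- **a diagonal mixing splits as an invertible diagonal times the coordinate projection onto its support**: `diagonal d = diagonal d′ · diagonal 1_{supp d}` with `d′ = d` on the
support and `1` off it. -/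
theorem diagonal_eq_support_mul_indicator [DecidableEq K] (d : Fin N → K) :
    Matrix.diagonal d = Matrix.diagonal (fun i => if d i ≠ 0 then d i else 1) *
      Matrix.diagonal (fun c => if c ∈ (Finset.univ.filter fun i => d i ≠ 0) then (1 : K) else 0) := by
  rw [Matrix.diagonal_mul_diagonal]
  congr 1
  funext i
  by_cases h : d i ≠ 0
  · simp [h]
  · push Not at h
    simp [h]

/-- the invertible part has non-zero determinant. -/
theorem det_diagonal_support_ne_zero [DecidableEq K] (d : Fin N → K) : (Matrix.diagonal fun i => if d i ≠ 0 then d i else (1 : K)).det ≠ 0 := by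
  rw [Matrix.det_diagonal]
  exact Finset.prod_ne_zero_iff.mpr fun i _ => by by_cases h : d i ≠ 0 <;> simp [h]

/-- the support has `rank (diagonal d)` elements. -/
theorem card_support_eq_rank_diagonal [DecidableEq K] (d : Fin N → K) : (Finset.univ.filter fun i => d i ≠ 0).card = (Matrix.diagonal d).rank := by
  rw [Matrix.rank_diagonal, Fintype.card_subtype]

/-! ## §256. The image of a kernel under an arbitrary mixing, as a named subspace after a change of frame -/

/-- **FOR EVERY MIXING `M`: `Pm(M)(Kr(univ, w_N q, k)) = Pm(Q)(Kr(univ, w_N q, k) ⊓ Sp(pairs ⊆ T))` for some INVERTIBLE `Q` and some `T` with `T.card = rank M`** — factor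
`M = L·diagonal(D)·L′` into transvections (Mathlib), let the invertible `L′` and the invertible part of `D` act trivially on `Kr` resp. be absorbed into `Q`, and apply J6 to the
coordinate projection onto the support of `D`. -/
theorem exists_map_Pm_Kr_w_eq (M : Matrix (Fin N) (Fin N) K) (q : ℕ → K) (k : ℕ) :
    ∃ (Q : Matrix (Fin N) (Fin N) K) (T : Finset (Fin N)), Q.det ≠ 0 ∧ T.card = M.rank ∧
      (Kr K Finset.univ (w K N N q) k).map (Pm K M).toLinearMap =
        (Kr K Finset.univ (w K N N q) k ⊓ Sp K (fun s : Finset (In N) => ∀ i ∈ s, pr i ∈ T)).map (Pm K Q).toLinearMap := by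
  classical
  obtain ⟨L, L', D, hM⟩ := Matrix.Pivot.exists_list_transvec_mul_diagonal_mul_list_transvec M
  have hP : (L.map Matrix.TransvectionStruct.toMatrix).prod.det ≠ 0 := by
    rw [Matrix.TransvectionStruct.det_toMatrix_prod]; exact one_ne_zero
  have hP' : (L'.map Matrix.TransvectionStruct.toMatrix).prod.det ≠ 0 := by
    rw [Matrix.TransvectionStruct.det_toMatrix_prod]; exact one_ne_zero
  refine ⟨(L.map Matrix.TransvectionStruct.toMatrix).prod * Matrix.diagonal (fun i => if D i ≠ 0 then D i else 1), Finset.univ.filter (fun i => D i ≠ 0), ?_, ?_, ?_⟩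
  · rw [Matrix.det_mul]; exact mul_ne_zero hP (det_diagonal_support_ne_zero K D)
  · rw [hM, Matrix.rank_mul_eq_left_of_isUnit_det _ _ (isUnit_iff_ne_zero.mpr hP'), Matrix.rank_mul_eq_right_of_isUnit_det _ _ (isUnit_iff_ne_zero.mpr hP),
      card_support_eq_rank_diagonal]
  · rw [hM, map_Pm_mul, map_Pm_Kr_w_of_det_ne_zero K hP', diagonal_eq_support_mul_indicator K D, ← Matrix.mul_assoc, map_Pm_mul, map_Pm_indicator_Kr_w]

/-- **the same for the images: `Pm(M)(V(univ, w_N q, k)) = Pm(Q)(V(univ, w_N q, k) ⊓ Sp(pairs ⊆ T))`**, `det Q ≠ 0`, `T.card = rank M`. -/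
theorem exists_map_Pm_V_w_eq (M : Matrix (Fin N) (Fin N) K) (q : ℕ → K) (k : ℕ) :
    ∃ (Q : Matrix (Fin N) (Fin N) K) (T : Finset (Fin N)), Q.det ≠ 0 ∧ T.card = M.rank ∧
      (V K (In N) Finset.univ (w K N N q) k).map (Pm K M).toLinearMap =
        (V K (In N) Finset.univ (w K N N q) k ⊓ Sp K (fun s : Finset (In N) => ∀ i ∈ s, pr i ∈ T)).map (Pm K Q).toLinearMap := by
  classical
  obtain ⟨L, L', D, hM⟩ := Matrix.Pivot.exists_list_transvec_mul_diagonal_mul_list_transvec M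
  have hP : (L.map Matrix.TransvectionStruct.toMatrix).prod.det ≠ 0 := by
    rw [Matrix.TransvectionStruct.det_toMatrix_prod]; exact one_ne_zero
  have hP' : (L'.map Matrix.TransvectionStruct.toMatrix).prod.det ≠ 0 := by
    rw [Matrix.TransvectionStruct.det_toMatrix_prod]; exact one_ne_zero
  refine ⟨(L.map Matrix.TransvectionStruct.toMatrix).prod * Matrix.diagonal (fun i => if D i ≠ 0 then D i else 1), Finset.univ.filter (fun i => D i ≠ 0), ?_, ?_, ?_⟩
  · rw [Matrix.det_mul]; exact mul_ne_zero hP (det_diagonal_support_ne_zero K D)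
  · rw [hM, Matrix.rank_mul_eq_left_of_isUnit_det _ _ (isUnit_iff_ne_zero.mpr hP'), Matrix.rank_mul_eq_right_of_isUnit_det _ _ (isUnit_iff_ne_zero.mpr hP),
      card_support_eq_rank_diagonal]
  · rw [hM, map_Pm_mul, map_Pm_V_w_of_det_ne_zero K hP', diagonal_eq_support_mul_indicator K D, ← Matrix.mul_assoc, map_Pm_mul, map_Pm_indicator_V_w]

/-- **the dimension of the image: `dim Pm(M)(Kr(univ, w_N q, k)) = dim (Kr(univ, w_N q, k) ⊓ Sp(pairs ⊆ T))` for some `T` with `T.card = rank M`.** -/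
theorem exists_finrank_map_Pm_Kr_w_eq (M : Matrix (Fin N) (Fin N) K) (q : ℕ → K) (k : ℕ) :
    ∃ T : Finset (Fin N), T.card = M.rank ∧
      finrank K ↥((Kr K Finset.univ (w K N N q) k).map (Pm K M).toLinearMap) =
        finrank K ↥(Kr K Finset.univ (w K N N q) k ⊓ Sp K (fun s : Finset (In N) => ∀ i ∈ s, pr i ∈ T)) := by
  obtain ⟨Q, T, hQ, hT, h⟩ := exists_map_Pm_Kr_w_eq K M q k
  exact ⟨T, hT, by rw [h, finrank_map_Pm_of_det_ne_zero K hQ]⟩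

end Summit.Ventures.HSemireg.Wedge.HankelPairMixing
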